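import Summits.AnomalousDissipation.AnomalousDissipation.Theorems.BaireTransferDenseLoudDesignerForcesErgodicLine
import Literature.Analysis.FluidPDE.TorusLinearisedNSH3Smoothing

/-!
# `V → H³` smoothing of the linearised flow on `T³` (tools stub `stub_linearisedH3SmoothingTools`, block N-R, line
# `ergodic-budget-selection-closing`, crux `BaireTransfer.DenseLoudDesignerForces`, stmt-AnomalousDissipation-1143)

Summit-side specialisation to `T³ = UnitAddTorus (Fin 3)` of the Literature estimate
`Torus.linearisedNS_gradNormSq_laplacian_le_mul` (`Literature/Analysis/FluidPDE/TorusLinearisedNSH3Smoothing.lean`,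
over the `H³` balance and flux bound of `Literature/Analysis/FluidPDE/TorusLinearisedNSH3Balance.lean` and the bilinear
`H²` product bound of `Literature/Analysis/FunctionSpaces/TorusConvectionLaplacianNormSqBilinear.lean`), read against
the line's predicate `IsLinearizedNSSolutionOn S ν u w q` (file `…ErgodicLine.lean`: `w, q` jointly smooth,
`div w(t) = 0`, `∫ w(t) = 0`, `∂ₜw + (u·∇)w + (w·∇)u = νΔw − ∇q`): along a jointly smooth divergence-free base field
`u` on `[a, a + τ] × T³` with `‖u‖ ≤ M`, `‖∂ᵢu‖ ≤ Λ₁`, `‖∂ᵢ∂ⱼu‖ ≤ Λ₂`, `‖Δu(t)‖₂² ≤ Y₁` and `‖∇Δu(t)‖₂² ≤ Z₁`, every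
linearised solution satisfies `‖∇Δw(a + τ)‖₂² ≤ C(ν, M, Λ₁, Y₁, Z₁, τ) (‖w(a)‖₂² + ‖∇w(a)‖₂²)` — the solution operator
of the first variation equation maps `V` boundedly into `D(A^{3/2})` after any positive time lapse (Constantin–Foias
1988 Ch. 14, two Sobolev levels above "`S'(t, u₀)` maps `H` into `V` boundedly"), so that the linearised vector field
`νΔw − P((u·∇)w + (w·∇)u)` lands in `V` at positive times (time regularity of the derivative cocycle, brick S4b of
block N-R).  The Hessian level `Λ₂` of the registered signature is not needed by the estimate (the terms of
`Δ((u·∇)w + (w·∇)u)` with two or three derivatives on `u` are square integrated against the sup norms of `w`, `∂w`,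
which `H³` controls on `T³`); it is kept because the registered signature carries it.  The registered tools stub
`stub_linearisedH3SmoothingTools` is proved BY NAME with exactly the registered signature.

References: P. Constantin, C. Foias, *Navier–Stokes Equations* (1988) Ch. 14 (14.2)–(14.4), Prop. 13.2, Thm 10.6;
R. Temam, *Infinite-Dimensional Dynamical Systems in Mechanics and Physics* (1997) Ch. VI §3.1.
-/

-- `Summit.<Summit>.<Problem>` is the tree's mandated summit-side namespace (CONVENTIONS §2); for this
-- single-conjunct summit the two coincide, so the duplicate is deliberate.
set_option linter.dupNamespace false

noncomputable section

open scoped BigOperators Topology ENNReal InnerProductSpace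
open Filter Set Function MeasureTheory

namespace Summit.AnomalousDissipation.AnomalousDissipation.Theorems.DenseLoudDesignerForces.Ergodic

open Literature.Analysis.FunctionSpaces Literature.Analysis.FunctionSpaces.Torus
open Literature.Analysis.FluidPDE Literature.Analysis.FluidPDE.Torus

/-- **Tools stub T1 of block N-R (`stub_linearisedH3SmoothingTools`, crux stmt-AnomalousDissipation-1143, line
`ergodic-budget-selection-closing`) — `V → H³` smoothing of the linearised flow.**  For `ν > 0`, levels
`M, Λ₁, Λ₂, Y₁, Z₁` and a time lapse `τ > 0` there is `C` such that: along every jointly smooth divergence-free base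
field `u` on `[a, a + τ] × T³` with `‖u‖ ≤ M`, `‖∂ᵢu‖ ≤ Λ₁`, `‖∂ᵢ∂ⱼu‖ ≤ Λ₂`, `‖Δu(t)‖₂² ≤ Y₁` and `‖∇Δu(t)‖₂² ≤ Z₁`,
every solution `(w, q)` of the linearised system (`IsLinearizedNSSolutionOn`: smooth, divergence free, mean zero)
satisfies `‖∇Δw(a + τ)‖₂² ≤ C (∫ ‖w(a)‖² + ‖∇w(a)‖₂²)` — the `H¹`, `H²`, `H³` balances of the linearised equation
with their flux bounds on `T³`, each keeping half of its dissipation, the exponential `H¹` bound of the linearised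
flow and the doubly weighted combination `(t − a)²·½‖∇Δw‖₂² + κ₁(t − a)·½‖Δw‖₂² + κ₂·½‖∇w‖₂²`
(`Torus.linearisedNS_gradNormSq_laplacian_le_mul` at `d = Fin 3`, the conjunction `IsLinearizedNSSolutionOn`
unpacked; the Hessian level `Λ₂` is not used).  Constantin–Foias 1988 Ch. 14, "`S′(t,u₀) : H → V` bounded", two
levels up. [cite: ConstantinFoiasNSE1988, Ch. 14 (text after (14.4)) with Prop. 13.2 and Thm 10.6] -/
theorem stub_linearisedH3SmoothingTools {ν : ℝ} (hν : 0 < ν) (M Λ₁ Λ₂ Y₁ Z₁ τ : ℝ) (hτ : 0 < τ) :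
    ∃ C : ℝ, ∀ {a : ℝ} {u w : ℝ → (UnitAddTorus (Fin 3)) → (EuclideanSpace ℝ (Fin 3))} {q : ℝ → (UnitAddTorus (Fin 3)) → ℝ},
      IsSmoothSpaceTimeOn (Icc a (a + τ)) u → (∀ t ∈ Icc a (a + τ), IsDivFree (u t)) →
      (∀ t ∈ Icc a (a + τ), ∀ x, ‖u t x‖ ≤ M) → (∀ i, ∀ t ∈ Icc a (a + τ), ∀ x, ‖partialDeriv i (u t) x‖ ≤ Λ₁) →
      (∀ i j, ∀ t ∈ Icc a (a + τ), ∀ x, ‖partialDeriv i (partialDeriv j (u t)) x‖ ≤ Λ₂) →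
      (∀ t ∈ Icc a (a + τ), ∫ x, ‖laplacian (u t) x‖ ^ 2 ≤ Y₁) → (∀ t ∈ Icc a (a + τ), gradNormSq (laplacian (u t)) ≤ Z₁) →
      IsLinearizedNSSolutionOn (Icc a (a + τ)) ν u w q →
      gradNormSq (laplacian (w (a + τ))) ≤ C * ((∫ x, ‖w a x‖ ^ 2) + gradNormSq (w a)) := by
  obtain ⟨C, hC⟩ := linearisedNS_gradNormSq_laplacian_le_mul (d := Fin 3) (Fintype.card_fin 3) hν M Λ₁ Y₁ Z₁ hτ
  exact ⟨C, fun hu hudiv hM hΛ _ hY hZ h => hC hu hudiv hM hΛ hY hZ h.1 h.2.1 h.2.2.1 h.2.2.2.1 h.2.2.2.2⟩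

end Summit.AnomalousDissipation.AnomalousDissipation.Theorems.DenseLoudDesignerForces.Ergodic

end
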